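import Summits.ResolutionOfSingularities.ResolutionOfSingularities.Theorems.FrobeniusLadderFInjectiveMacaulayficationT4GermChar7
import Summits.ResolutionOfSingularities.ResolutionOfSingularities.Theorems.FrobeniusLadderFInjectiveMacaulayficationHypersurfaceOriginNotFull
import Mathlib.RingTheory.Nilpotent.Basic
import HarnessLib

/-!
# The T⁽⁴⁾/7 origin is a BAD point: `¬ FullCl 7 𝒪_{X,b}` — non-vacuity of res-L1-w45a-stub-3's informative-stratum instance p601374
# (crux `FInjectiveMacaulayfication` stmt-ResolutionOfSingularities-15315, chain w45a; res-L1-w45a-plan-1 NAMED OBJECT 04:16:17Z for res-L1-w45a-stub-1 g9; census currency of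
# res-L1-w45a-tri-2 #369 «¬FULL at v ∧ FInjectivizationGermAt p v»; seat res-L1-w45a-stub-1 g9)

[OURS · L1 W4.5a] Support file (`--supports stmt-ResolutionOfSingularities-15315 --as helper`); replaces the role of NO printed item; NOT a
statement of the manuscript; def-free, unconditional; a CERTIFICATE. AI-written (AI review is weaker than expert review).

## What is here (`g = X₂² + (X₁² + X₀³)³ + X₃⁷ + X₄⁸ + X₀¹²`, `char k = 7`, `X = Spec k[X]/(g)`, `b` = the origin)
* `g_pow_six_mem_frobeniusPower` — **`g⁶ ∈ (X₀⁷, …, X₄⁷) = 𝔪^{[7]}`** (Fedder's membership): in `k[X]/(Xᵢ⁷)` one has `(x̄₂²)⁴ = 0` and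
  `b̄³ = 0` for `b = (X₁²+X₀³)³ + X₃⁷ + X₄⁸ + X₀¹²` (`(x̄₁² + x̄₀³)⁹ = 0` because `(x̄₁²)⁴ = (x̄₀³)³ = 0`; the other summands vanish), hence
  `ḡ⁶ = (x̄₂² + b̄)⁶ = 0` (`Commute.add_pow_eq_zero_of_add_le_succ_of_pow_eq_zero`, `4 + 3 ≤ 6 + 1`) — NO expansion of `g⁶` is needed.
* ★ `t4_origin_not_fullCl : ¬ FullCl 7 𝒪_{X,b}` via `HypersurfaceOriginNotFull.not_fullCl_stalk_origin_of_fedder_mem` (p603303, generic Fedder necessity).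
* ★★ `t4_origin_bad_germ_instance` — the conjunction with `T4GermChar7.t4_origin_germ_instance` (p601374): the FIRST informative-stratum row at `d = 4`, `p = 7` in the census
  currency «¬FULL at `b` ∧ the five germ hypotheses ∧ `FInjectivizationGermAt 7 b`» — the instance is NOT the vacuous `𝓚 = ⊤` one.

[folklore mathematics, OURS as a certificate; cite: Fedder1983, Prop. 1.7]
-/

-- single-problem summit: the doubled namespace component is forced
set_option linter.dupNamespace false

noncomputable section

open AlgebraicGeometry CategoryTheory Literature.AlgebraicGeometry.Resolution TopologicalSpace IsLocalRing MvPolynomial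

namespace Summit.ResolutionOfSingularities.ResolutionOfSingularities.Theorems.FInjectiveMacaulayfication.T4GermChar7NotFull

open Summit.ResolutionOfSingularities.ResolutionOfSingularities.Theorems.FInjectiveMacaulayfication
open SliceableCentre GermForm

/-! ## §1 `g⁶ ∈ 𝔪^{[7]}` without expanding -/

/-- **`g⁶ ∈ (X₀⁷, …, X₄⁷)`** for `g = X₂² + (X₁² + X₀³)³ + X₃⁷ + X₄⁸ + X₀¹²` (any commutative coefficient field; no characteristic hypothesis).
[folklore] -/
theorem g_pow_six_mem_frobeniusPower (k : Type) [Field k] (g : MvPolynomial (Fin 5) k)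
    (hg : g = X 2 ^ 2 + (X 1 ^ 2 + X 0 ^ 3) ^ 3 + X 3 ^ 7 + X 4 ^ 8 + X 0 ^ 12) :
    g ^ (7 - 1) ∈ Ideal.span (Set.range fun i : Fin 5 => (X i : MvPolynomial (Fin 5) k) ^ 7) := by
  set M : Ideal (MvPolynomial (Fin 5) k) := Ideal.span (Set.range fun i : Fin 5 => (X i : MvPolynomial (Fin 5) k) ^ 7) with hM
  rw [← Ideal.Quotient.eq_zero_iff_mem, map_pow, show (7 - 1 : ℕ) = 6 from rfl]
  set mk := Ideal.Quotient.mk M with hmk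
  have hX7 : ∀ i : Fin 5, mk (X i) ^ 7 = 0 := fun i => by
    rw [← map_pow, Ideal.Quotient.eq_zero_iff_mem]
    exact Ideal.subset_span ⟨i, rfl⟩
  have hpow : ∀ (i : Fin 5) (n : ℕ), 7 ≤ n → mk (X i) ^ n = 0 := fun i n hn => by
    rw [← Nat.sub_add_cancel hn, pow_add, hX7 i, mul_zero]
  -- `(x̄₂²)⁴ = 0`
  have h2 : (mk (X 2) ^ 2) ^ 4 = 0 := by rw [← pow_mul]; exact hpow 2 8 (by norm_num)
  -- `(x̄₁² + x̄₀³)⁹ = 0`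
  have hc : (mk (X 1) ^ 2 + mk (X 0) ^ 3) ^ 9 = 0 :=
    Commute.add_pow_eq_zero_of_add_le_succ_of_pow_eq_zero (Commute.all _ _) (m := 4) (n := 3)
      (by rw [← pow_mul]; exact hpow 1 8 (by norm_num)) (by rw [← pow_mul]; exact hpow 0 9 (by norm_num)) (by norm_num)
  -- `b̄³ = 0` for the tail `b`
  have hb : (mk ((X 1 ^ 2 + X 0 ^ 3) ^ 3 + X 3 ^ 7 + X 4 ^ 8 + X 0 ^ 12)) ^ 3 = 0 := by
    have e : mk ((X 1 ^ 2 + X 0 ^ 3) ^ 3 + X 3 ^ 7 + X 4 ^ 8 + X 0 ^ 12) = (mk (X 1) ^ 2 + mk (X 0) ^ 3) ^ 3 := by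
      simp only [map_add, map_pow, hpow 3 7 le_rfl, hpow 4 8 (by norm_num), hpow 0 12 (by norm_num), add_zero]
    rw [e, ← pow_mul]
    exact hc
  -- `ḡ = x̄₂² + b̄`, `ḡ⁶ = 0`
  have e : mk g = mk (X 2) ^ 2 + mk ((X 1 ^ 2 + X 0 ^ 3) ^ 3 + X 3 ^ 7 + X 4 ^ 8 + X 0 ^ 12) := by
    rw [hg]
    simp only [map_add, map_pow]
    ring
  rw [e]
  exact Commute.add_pow_eq_zero_of_add_le_succ_of_pow_eq_zero (Commute.all _ _) h2 hb (by norm_num)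

/-! ## §2 The origin of T⁽⁴⁾/7 is NOT FULL -/

/-- ★ **`¬ FullCl 7 𝒪_{X,b}` at the origin `b` of `X = V(X₂² + (X₁² + X₀³)³ + X₃⁷ + X₄⁸ + X₀¹²)`, `char k = 7`** (Fedder necessity: `g⁶ ∈ 𝔪^{[7]}`).
[cite: Fedder1983, Prop. 1.7] -/
theorem t4_origin_not_fullCl (k : Type) [Field k] [CharP k 7] (g : MvPolynomial (Fin 5) k)
    (hg : g = X 2 ^ 2 + (X 1 ^ 2 + X 0 ^ 3) ^ 3 + X 3 ^ 7 + X 4 ^ 8 + X 0 ^ 12)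
    (b : Spec (.of (MvPolynomial (Fin 5) k ⧸ Ideal.span {g})))
    (hb : b.asIdeal = Ideal.span (Set.range fun j : Fin 5 => Ideal.Quotient.mk (Ideal.span {g}) (X j))) :
    ¬ FullCl 7 ((Spec (.of (MvPolynomial (Fin 5) k ⧸ Ideal.span {g}))).presheaf.stalk b) := by
  haveI : Fact (Nat.Prime 7) := ⟨by norm_num⟩
  exact HypersurfaceOriginNotFull.not_fullCl_stalk_origin_of_fedder_mem 7 k g (T4GermChar7.g_ne_zero k g hg)
    (T4GermChar7.constantCoeff_g k g hg) (g_pow_six_mem_frobeniusPower k g hg) b hb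

/-- ★★ **T⁽⁴⁾/7: the origin is a BAD point AND a positive instance of the germ form** — conjunction of `t4_origin_not_fullCl` with res-L1-w45a-stub-3's
`T4GermChar7.t4_origin_germ_instance` (p601374): «¬FULL at b ∧ closed ∧ b ∉ Reg ∧ dim 4 ∧ isolated ∧ CMCl ∧ `FInjectivizationGermAt 7 b`» — the first
informative-stratum row at `d = 4`, `p = 7` in the census currency of res-L1-w45a-tri-2 #369. [folklore mathematics; OURS as a certificate] -/
theorem t4_origin_bad_germ_instance (k : Type) [Field k] [CharP k 7] (g : MvPolynomial (Fin 5) k)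
    (hg : g = X 2 ^ 2 + (X 1 ^ 2 + X 0 ^ 3) ^ 3 + X 3 ^ 7 + X 4 ^ 8 + X 0 ^ 12)
    (b : Spec (.of (MvPolynomial (Fin 5) k ⧸ Ideal.span {g})))
    (hb : b.asIdeal = Ideal.span (Set.range fun j : Fin 5 => Ideal.Quotient.mk (Ideal.span {g}) (X j))) :
    ¬ FullCl 7 ((Spec (.of (MvPolynomial (Fin 5) k ⧸ Ideal.span {g}))).presheaf.stalk b) ∧
    IsClosed ({b} : Set (Spec (.of (MvPolynomial (Fin 5) k ⧸ Ideal.span {g})))) ∧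
    b ∉ Scheme.regularLocus (Spec (.of (MvPolynomial (Fin 5) k ⧸ Ideal.span {g}))) ∧
    ringKrullDim ((Spec (.of (MvPolynomial (Fin 5) k ⧸ Ideal.span {g}))).presheaf.stalk b) = (4 : ℕ) ∧
    (∀ s : Spec ((Spec (.of (MvPolynomial (Fin 5) k ⧸ Ideal.span {g}))).presheaf.stalk b), s ≠ closedPoint _ →
      s ∈ Scheme.regularLocus (Spec ((Spec (.of (MvPolynomial (Fin 5) k ⧸ Ideal.span {g}))).presheaf.stalk b))) ∧
    (∀ s : Spec ((Spec (.of (MvPolynomial (Fin 5) k ⧸ Ideal.span {g}))).presheaf.stalk b),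
      CMCl ((Spec ((Spec (.of (MvPolynomial (Fin 5) k ⧸ Ideal.span {g}))).presheaf.stalk b)).presheaf.stalk s)) ∧
    FInjectivizationGermAt 7 b :=
  ⟨t4_origin_not_fullCl k g hg b hb, T4GermChar7.t4_origin_germ_instance k g hg b hb⟩

end Summit.ResolutionOfSingularities.ResolutionOfSingularities.Theorems.FInjectiveMacaulayfication.T4GermChar7NotFull

end
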